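import Summits.BirchSwinnertonDyer.BirchSwinnertonDyer.Theorems.PrintCFramBottomClassIndexLawFiveLeFlipRungTwoJunk
import HarnessLib

set_option autoImplicit false

/-!
# Crux `PrintCFram.BottomClassIndexLawFiveLe` (stmt-BirchSwinnertonDyer-20372), line `eisenstein-resource-bdp-line` (registry v29 `stub_flipRungs.2`,
# the `8 ∣ m` half = LEAD's residual `stub_rungTwoEight` / w6 g10's (JMLTwoEight⁶)):
# THE 2-ADIC FLIPPED-CUSP RUNG FOR `e = 3`, piece P6d — THE EVEN TRANSLATES AT `W₁₆ = γ₀·diag(256,1)` HAVE PERIOD `1/4` (THE JUNK)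
# (cell `bsd-print-cfram`, width seat `bsd-line-cfram-p1-w8` g10; THEOREMS ONLY, `--supports` 20372 `--as helper`; BSD is not proved by any of this)

HONEST FRAMING. Pure bookkeeping about points of `ℍ` and Shimura's automorphy factor; nothing here is a statement about BSD; no registered stub is
closed. This is the `R = 16` twin of w5 g8's P3 (`…FlipRungTwoJunk`, `R = 8`): at the flipped cusp `W₁₆ = γ₀·diag(256,1)`,
`γ₀ = [a b; M 256] ∈ SL₂(ℤ)` (`256a − bM = 1`, `M` the odd level), the class cut of `g` at modulus `16` splits into the ODD translates (P6c
`…FlipRungTwoEightFlipIdentity`, weights P6b `…FlipRungTwoEightWeights`) and the EVEN translates `g(j/16 + γ₀•(256w))`, `j = 2j₁`. Here: the even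
translates, normalised by `√(16(Mw+1))^κ`, are `(1/4)`-PERIODIC in `w`, so (w5 g8's generic `coeff_eq_of_junk_period_quarter`, imported) their
`q`-series carries only frequencies `≡ 0 (mod 4)` and cannot pollute the classes `n ≡ 2 (mod 4)` the `e = 3` rung reads.

* §1 THE CONJUGATION `N′ := (τ(j₁/8)γ₀)·τ(64)·(τ(j₁/8)γ₀)⁻¹ = [1 − 8Mu, u²; −64M², 1 + 8Mu]`, `u = 8a + Mj₁` — integral because `j` is even;
  `N′ • (j₁/8 + γ₀•w′) = j₁/8 + γ₀•(w′ + 64)`, `denom N′ (j₁/8 + γ₀•w′) = (M(w′+64)+256)/(Mw′+256)`.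
* §2 THE MULTIPLIER OF `N′` IS TRIVIAL: `ε_{1+8Mu} = 1` and Shimura's `(−64M² / 1+8Mu) = 1` ARE w5 g8's `thetaEps_one_add_four_mul (2M) u` and
  `shimuraSymbol_neg_sq_one_add_four_mul (M := 2M)`; `N′ ∈ Γ₀(N)` for `N ∣ 64M²`, `ψ(1 + 8Mu) = 1` for `N ∣ 8Mu` (both automatic at `N = 4M`).
* §3 **`junkTranslateSixteen_periodic_of_ratio`** (core, any admissible base pair `X, Y` with `Y/X = (M(w′+64)+256)/(Mw′+256)`) and
  **`junkTranslateSixteen_periodic_quarter`** (the variable `w`, `w′ = 256•w`, period `1/4`, P6c's base `X = 16(Mw+1)`).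

No definitions, no named facts, no `sorry`. beyond-print theorem: NO. References: [Shimura1973HalfIntegral] §1; [DiamondShurman2005] §1.1–1.2;
crux notes w7g8-T6 §1b, §5c (P3); w8 g10 STATUS 11:14:53Z (`N_j ∈ Γ₀(64M′²)`, `d ≡ 1 (16M′)`).
-/

-- summit-side namespace `Summit.BirchSwinnertonDyer.BirchSwinnertonDyer.…` (single-conjunct summit, D-0017 layout)
set_option linter.dupNamespace false

noncomputable section

open scoped MatrixGroups ModularForm Real Classical Topology NumberTheorySymbols
open UpperHalfPlane hiding I
open Complex Matrix.GeneralLinearGroup CongruenceSubgroup Function Filter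
open Literature.NumberTheory.EllipticCurves.ModularForms

namespace Summit.BirchSwinnertonDyer.BirchSwinnertonDyer.Theorems.PrintCFram.FlipRung

/-! ## §1 The conjugation matrix `N′` and the point identity at modulus `16` -/

/-- **Determinant of `N′ = [1 − 8Mu, u²; −64M², 1 + 8Mu]`** (`u = 8a + Mj₁`). [folklore] -/
theorem det_junkConjSixteen_eq_one (M a j₁ : ℤ) :
    Matrix.det !![1 - 8 * M * (8 * a + M * j₁), (8 * a + M * j₁) ^ 2; -(64 * M ^ 2), 1 + 8 * M * (8 * a + M * j₁)] = 1 := by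
  rw [Matrix.det_fin_two_of]
  ring

/-- **The Möbius identity behind the even translates at modulus `16`** (as complex numbers). With `256a − bM = 1`, `Mw + 256 ≠ 0` and
`M(w+64) + 256 ≠ 0`: `N′` applied to `j₁/8 + (aw+b)/(Mw+256)` is `j₁/8 + (a(w+64)+b)/(M(w+64)+256)`, and its denominator there is
`(M(w+64)+256)/(Mw+256)`. [cite: DiamondShurman2005, §1.2] -/
theorem junkConjSixteen_moebius_eq {a b M j₁ w : ℂ} (hdet : a * 256 - b * M = 1) (hw : M * w + 256 ≠ 0)
    (hw64 : M * (w + 64) + 256 ≠ 0) :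
    ((1 - 8 * M * (8 * a + M * j₁)) * (j₁ / 8 + (a * w + b) / (M * w + 256)) + (8 * a + M * j₁) ^ 2) /
        (-(64 * M ^ 2) * (j₁ / 8 + (a * w + b) / (M * w + 256)) + (1 + 8 * M * (8 * a + M * j₁))) =
      j₁ / 8 + (a * (w + 64) + b) / (M * (w + 64) + 256) ∧
    -(64 * M ^ 2) * (j₁ / 8 + (a * w + b) / (M * w + 256)) + (1 + 8 * M * (8 * a + M * j₁)) =
      (M * (w + 64) + 256) / (M * w + 256) := by
  have hden : -(64 * M ^ 2) * (j₁ / 8 + (a * w + b) / (M * w + 256)) + (1 + 8 * M * (8 * a + M * j₁)) =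
      (M * (w + 64) + 256) / (M * w + 256) := by
    rw [eq_div_iff hw]
    field_simp
    linear_combination (512 * M) * hdet
  have hnum : (1 - 8 * M * (8 * a + M * j₁)) * (j₁ / 8 + (a * w + b) / (M * w + 256)) + (8 * a + M * j₁) ^ 2 =
      (j₁ / 8 * (M * (w + 64) + 256) + (a * (w + 64) + b)) / (M * w + 256) := by
    rw [eq_div_iff hw]
    field_simp
    linear_combination (64 * (8 * a + M * j₁)) * hdet
  refine ⟨?_, hden⟩
  rw [hnum, hden, div_div_div_cancel_right₀ hw, add_div, mul_div_assoc, div_self hw64, mul_one]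

/-- **The even-translate conjugation read on `ℍ` (modulus `16`).** Let `γ₀ = [a b; M 256] ∈ SL₂(ℤ)`, `j₁ ∈ ℤ`, `u = 8a + Mj₁` and
`N′ = [1 − 8Mu, u²; −64M², 1 + 8Mu] ∈ SL₂(ℤ)`. Then for every `w′ ∈ ℍ`: `N′ • (j₁/8 + γ₀•w′) = j₁/8 + γ₀•(w′ + 64)` and
`denom N′ (j₁/8 + γ₀•w′) = (M(w′+64) + 256)/(Mw′ + 256)`. [cite: DiamondShurman2005, §1.2] -/
theorem junkConjSixteen_smul_eq (γ₀ N' : SL(2, ℤ)) {M : ℤ} (hM : γ₀ 1 0 = M) (h256 : γ₀ 1 1 = 256) (j₁ : ℤ)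
    (n00 : N' 0 0 = 1 - 8 * M * (8 * γ₀ 0 0 + M * j₁)) (n01 : N' 0 1 = (8 * γ₀ 0 0 + M * j₁) ^ 2)
    (n10 : N' 1 0 = -(64 * M ^ 2)) (n11 : N' 1 1 = 1 + 8 * M * (8 * γ₀ 0 0 + M * j₁)) (w : ℍ) :
    N' • (((j₁ : ℝ) / 8) +ᵥ (γ₀ • w)) = ((j₁ : ℝ) / 8) +ᵥ (γ₀ • ((64 : ℝ) +ᵥ w)) ∧
    denom N' (((j₁ : ℝ) / 8) +ᵥ (γ₀ • w)) = ((M : ℂ) * (((64 : ℝ) +ᵥ w : ℍ) : ℂ) + 256) / ((M : ℂ) * w + 256) := by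
  have hdetZ : γ₀ 0 0 * 256 - γ₀ 0 1 * M = 1 := by
    have := Matrix.det_fin_two (γ₀ : Matrix (Fin 2) (Fin 2) ℤ)
    rw [Matrix.SpecialLinearGroup.det_coe, hM, h256] at this
    linear_combination -this
  have hdetC : (γ₀ 0 0 : ℂ) * 256 - (γ₀ 0 1 : ℂ) * M = 1 := by exact_mod_cast hdetZ
  have hden0 : denom γ₀ w = (M : ℂ) * w + 256 := by
    rw [ModularGroup.denom_apply, hM, h256]; push_cast; ring
  have hden64 : denom γ₀ ((64 : ℝ) +ᵥ w) = (M : ℂ) * ((w : ℂ) + 64) + 256 := by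
    rw [ModularGroup.denom_apply, hM, h256, coe_vadd]; push_cast; ring
  have hw : (M : ℂ) * w + 256 ≠ 0 := by rw [← hden0]; exact denom_ne_zero γ₀ w
  have hw64 : (M : ℂ) * ((w : ℂ) + 64) + 256 ≠ 0 := by rw [← hden64]; exact denom_ne_zero γ₀ _
  obtain ⟨hmob, hden⟩ := junkConjSixteen_moebius_eq (j₁ := (j₁ : ℂ)) hdetC hw hw64
  have hγw : ((γ₀ • w : ℍ) : ℂ) = ((γ₀ 0 0 : ℂ) * w + (γ₀ 0 1 : ℂ)) / ((M : ℂ) * w + 256) := by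
    rw [coe_specialLinearGroup_apply, hM, h256]
    simp only [eq_intCast, Int.cast_ofNat]
    push_cast
    ring
  have hγw64 : ((γ₀ • ((64 : ℝ) +ᵥ w) : ℍ) : ℂ) =
      ((γ₀ 0 0 : ℂ) * ((w : ℂ) + 64) + (γ₀ 0 1 : ℂ)) / ((M : ℂ) * ((w : ℂ) + 64) + 256) := by
    rw [coe_specialLinearGroup_apply, hM, h256, coe_vadd]
    simp only [eq_intCast, Int.cast_ofNat]
    push_cast
    ring_nf
  have hpt : ((((j₁ : ℝ) / 8) +ᵥ (γ₀ • w) : ℍ) : ℂ) = (j₁ : ℂ) / 8 + ((γ₀ 0 0 : ℂ) * w + (γ₀ 0 1 : ℂ)) / ((M : ℂ) * w + 256) := by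
    rw [coe_vadd, hγw]; push_cast; ring
  constructor
  · apply UpperHalfPlane.ext
    rw [coe_specialLinearGroup_apply, hpt, coe_vadd, hγw64]
    simp only [n00, n01, n10, n11, eq_intCast, Int.cast_add, Int.cast_mul, Int.cast_pow, Int.cast_sub, Int.cast_one,
      Int.cast_neg, Int.cast_ofNat]
    push_cast
    rw [hmob]
  · rw [ModularGroup.denom_apply, hpt, n10, n11, coe_vadd]
    push_cast
    rw [hden]
    ring_nf

/-! ## §2 The multiplier of `N′` is trivial (w5 g8's lemmas at `2M`) -/

/-- `ε_{1 + 8Mu} = 1` (w5 g8's `thetaEps_one_add_four_mul` at `2M`). [folklore] -/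
theorem thetaEps_one_add_eight_mul (M u : ℤ) : thetaEps (1 + 8 * M * u) = 1 := by
  rw [show 1 + 8 * M * u = 1 + 4 * (2 * M) * u by ring]
  exact thetaEps_one_add_four_mul (2 * M) u

/-- **Shimura's symbol `(−64M² / 1 + 8Mu) = 1` for `M ≠ 0`** (w5 g8's `shimuraSymbol_neg_sq_one_add_four_mul` at `2M`, both signs of `d`).
[cite: Shimura1973HalfIntegral, §1] -/
theorem shimuraSymbol_neg_sq_one_add_eight_mul {M : ℤ} (hM : M ≠ 0) (u : ℤ) :
    shimuraSymbol (-(64 * M ^ 2)) (1 + 8 * M * u) = 1 := by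
  rw [show -(64 * M ^ 2) = -(16 * (2 * M) ^ 2) by ring, show 1 + 8 * M * u = 1 + 4 * (2 * M) * u by ring]
  exact shimuraSymbol_neg_sq_one_add_four_mul (mul_ne_zero two_ne_zero hM) u

/-- `N′ ∈ Γ₀(N)` when `N ∣ 64M²`. [folklore] -/
theorem junkConjSixteen_mem_Gamma0 {N : ℕ} (N' : SL(2, ℤ)) {M : ℤ} (n10 : N' 1 0 = -(64 * M ^ 2))
    (hNc : (N : ℤ) ∣ 64 * M ^ 2) : N' ∈ Gamma0 N := by
  rw [Gamma0_mem, n10, ZMod.intCast_zmod_eq_zero_iff_dvd]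
  exact (dvd_neg).mpr hNc

/-- `Mw′ + 256` lies in the upper half-plane for `M > 0`. [folklore] -/
theorem im_level_mul_add_pos_sixteen {M : ℤ} (hM : 0 < M) (w : ℍ) (r : ℝ) : 0 < ((M : ℂ) * ((w : ℂ) + r) + 256).im := by
  have : ((M : ℂ) * ((w : ℂ) + r) + 256).im = (M : ℝ) * w.im := by simp
  rw [this]; exact mul_pos (by exact_mod_cast hM) w.im_pos

/-- **The automorphy factor of `N′` at the even translate (modulus `16`).** In the setting of `junkConjSixteen_smul_eq` with `M ≠ 0` and
`N ∣ 8Mu`: `χ(d′)·j(N′, z)^κ` at `z = j₁/8 + γ₀•w′` equals `√((M(w′+64)+256)/(Mw′+256))^κ`. [cite: Shimura1973HalfIntegral, §1] -/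
theorem autFactor_junkConjSixteen_eq {κ N : ℕ} (ψ : DirichletCharacter ℂ N) (γ₀ N' : SL(2, ℤ)) {M : ℤ} (hM : γ₀ 1 0 = M)
    (h256 : γ₀ 1 1 = 256) (hM0 : M ≠ 0) (j₁ : ℤ)
    (n00 : N' 0 0 = 1 - 8 * M * (8 * γ₀ 0 0 + M * j₁)) (n01 : N' 0 1 = (8 * γ₀ 0 0 + M * j₁) ^ 2)
    (n10 : N' 1 0 = -(64 * M ^ 2)) (n11 : N' 1 1 = 1 + 8 * M * (8 * γ₀ 0 0 + M * j₁))
    (hNd : (N : ℤ) ∣ 8 * M * (8 * γ₀ 0 0 + M * j₁)) (w : ℍ) :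
    autFactor κ N ψ N' (((j₁ : ℝ) / 8) +ᵥ (γ₀ • w)) =
      Complex.sqrt (((M : ℂ) * ((w : ℂ) + 64) + 256) / ((M : ℂ) * w + 256)) ^ κ := by
  obtain ⟨-, hden⟩ := junkConjSixteen_smul_eq γ₀ N' hM h256 j₁ n00 n01 n10 n11 w
  have hψ : ψ ((N' 1 1 : ℤ) : ZMod N) = 1 := by
    rw [n11]
    have h1 : (((1 + 8 * M * (8 * γ₀ 0 0 + M * j₁) : ℤ)) : ZMod N) = 1 := by
      rw [Int.cast_add, Int.cast_one, (ZMod.intCast_zmod_eq_zero_iff_dvd _ N).mpr hNd, add_zero]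
    rw [h1, map_one]
  have hθ : thetaFactor (N' 1 0) (N' 1 1) (((j₁ : ℝ) / 8) +ᵥ (γ₀ • w)) =
      Complex.sqrt (((M : ℂ) * ((w : ℂ) + 64) + 256) / ((M : ℂ) * w + 256)) := by
    unfold thetaFactor
    have hcd : ((N' 1 0 : ℤ) : ℂ) * ((((j₁ : ℝ) / 8) +ᵥ (γ₀ • w) : ℍ) : ℂ) + ((N' 1 1 : ℤ) : ℂ) =
        ((M : ℂ) * ((w : ℂ) + 64) + 256) / ((M : ℂ) * w + 256) := by
      rw [← ModularGroup.denom_apply, hden, coe_vadd]; push_cast; ring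
    rw [hcd, n11, n10, thetaEps_one_add_eight_mul, shimuraSymbol_neg_sq_one_add_eight_mul hM0]
    simp
  rw [autFactor, hψ, hθ, one_mul]

/-! ## §3 The even translates, normalised, have period `64` in `w′ = 256•w`, i.e. `1/4` in `w` -/

/-- **P6d, CORE FORM: THE NORMALISED EVEN TRANSLATE IS PERIODIC**, with ANY admissible normalisation base. Let `g ∈ M_{κ/2}(N, ψ)` (`4 ∣ N`),
`γ₀ = [a b; M 256] ∈ SL₂(ℤ)` with `M ≠ 0`, `N ∣ 64M²`, `N ∣ 8M(8a + Mj₁)` (both automatic for `N = 4M`), and let `X, Y` in the upper half-plane have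
the ratio `Y/X = (M(w′+64)+256)/(Mw′+256)`. Then `g(j₁/8 + γ₀•(w′+64))·(√Y^κ)⁻¹ = g(j₁/8 + γ₀•w′)·(√X^κ)⁻¹`. [cite: Shimura1973HalfIntegral, §1] -/
theorem junkTranslateSixteen_periodic_of_ratio {κ N : ℕ} {ψ : DirichletCharacter ℂ N} (hN4 : 4 ∣ N) {g : ℍ → ℂ}
    (hg : g ∈ halfIntModularForms κ N ψ) (γ₀ : SL(2, ℤ)) {M : ℤ} (hM : γ₀ 1 0 = M) (h256 : γ₀ 1 1 = 256)
    (hM0 : M ≠ 0) (hNc : (N : ℤ) ∣ 64 * M ^ 2) (j₁ : ℤ) (hNd : (N : ℤ) ∣ 8 * M * (8 * γ₀ 0 0 + M * j₁)) (w : ℍ)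
    {X Y : ℂ} (hX : 0 < X.im) (hY : 0 < Y.im) (hXY : Y / X = ((M : ℂ) * ((w : ℂ) + 64) + 256) / ((M : ℂ) * w + 256)) :
    g (((j₁ : ℝ) / 8) +ᵥ (γ₀ • ((64 : ℝ) +ᵥ w))) * (Complex.sqrt Y ^ κ)⁻¹ =
      g (((j₁ : ℝ) / 8) +ᵥ (γ₀ • w)) * (Complex.sqrt X ^ κ)⁻¹ := by
  let N' : SL(2, ℤ) := ⟨!![1 - 8 * M * (8 * γ₀ 0 0 + M * j₁), (8 * γ₀ 0 0 + M * j₁) ^ 2;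
      -(64 * M ^ 2), 1 + 8 * M * (8 * γ₀ 0 0 + M * j₁)], det_junkConjSixteen_eq_one M (γ₀ 0 0) j₁⟩
  have n00 : N' 0 0 = 1 - 8 * M * (8 * γ₀ 0 0 + M * j₁) := rfl
  have n01 : N' 0 1 = (8 * γ₀ 0 0 + M * j₁) ^ 2 := rfl
  have n10 : N' 1 0 = -(64 * M ^ 2) := rfl
  have n11 : N' 1 1 = 1 + 8 * M * (8 * γ₀ 0 0 + M * j₁) := rfl
  obtain ⟨hsmul, -⟩ := junkConjSixteen_smul_eq γ₀ N' hM h256 j₁ n00 n01 n10 n11 w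
  have hmem : N' ∈ Gamma0 N := junkConjSixteen_mem_Gamma0 N' n10 hNc
  have haut := apply_smul_eq_of_mem (k := κ) (χ := ψ) hN4 hg hmem (((j₁ : ℝ) / 8) +ᵥ (γ₀ • w))
  rw [hsmul, autFactor_junkConjSixteen_eq ψ γ₀ N' hM h256 hM0 j₁ n00 n01 n10 n11 hNd w, ← hXY,
    csqrt_div_eq_of_im_pos hX hY, div_pow] at haut
  have hsX : Complex.sqrt X ^ κ ≠ 0 := by
    refine pow_ne_zero κ fun h0 ↦ ?_
    have : X = 0 := by rw [← csqrt_sq X, h0]; ring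
    rw [this] at hX; simp at hX
  have hsY : Complex.sqrt Y ^ κ ≠ 0 := by
    refine pow_ne_zero κ fun h0 ↦ ?_
    have : Y = 0 := by rw [← csqrt_sq Y, h0]; ring
    rw [this] at hY; simp at hY
  rw [haut]
  field_simp

/-- **P6d IN THE VARIABLE `w` WITH P6c's BASE `√(16(Mw+1))`** (`w′ = 256•w`, period `1/4`): for `M > 0`, `N = any level with 4 ∣ N`,
`N ∣ 64M²`, `N ∣ 8M(8a + Mj₁)`, and any positive-real dilation `c` with `(c : ℝ) = 256`,
`g(j₁/8 + γ₀•(c•(w + 1/4)))·(√(16(M(w+1/4)+1))^κ)⁻¹ = g(j₁/8 + γ₀•(c•w))·(√(16(Mw+1))^κ)⁻¹`. So the even part of the class cut (modulus `16`)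
at the flipped cusp, divided by P6c's common base, is `(1/4)`-periodic and (w5 g8's `coeff_eq_of_junk_period_quarter`) carries only the frequencies
`4 ∣ n` of `e(nw)` — never the classes `n ≡ 2 (mod 4)` of the `e = 3` rung. [cite: Shimura1973HalfIntegral, §1] -/
theorem junkTranslateSixteen_periodic_quarter {κ N : ℕ} {ψ : DirichletCharacter ℂ N} (hN4 : 4 ∣ N) {g : ℍ → ℂ}
    (hg : g ∈ halfIntModularForms κ N ψ) (γ₀ : SL(2, ℤ)) {M : ℤ} (hM : γ₀ 1 0 = M) (h256 : γ₀ 1 1 = 256)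
    (hMpos : 0 < M) (hNc : (N : ℤ) ∣ 64 * M ^ 2) (j₁ : ℤ) (hNd : (N : ℤ) ∣ 8 * M * (8 * γ₀ 0 0 + M * j₁))
    (c : {x : ℝ // 0 < x}) (hc : (c : ℝ) = 256) (w : ℍ) :
    g (((j₁ : ℝ) / 8) +ᵥ (γ₀ • (c • ((1 / 4 : ℝ) +ᵥ w)))) *
        (Complex.sqrt (16 * ((M : ℂ) * ((((1 / 4 : ℝ) +ᵥ w : ℍ)) : ℂ) + 1)) ^ κ)⁻¹ =
      g (((j₁ : ℝ) / 8) +ᵥ (γ₀ • (c • w))) * (Complex.sqrt (16 * ((M : ℂ) * w + 1)) ^ κ)⁻¹ := by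
  have h1 : c • ((1 / 4 : ℝ) +ᵥ w) = (64 : ℝ) +ᵥ (c • w) := by
    rw [posSMul_vadd, hc]; norm_num
  have hcw : (((c • w : ℍ)) : ℂ) = 256 * (w : ℂ) := by
    rw [coe_pos_real_smul, hc, Complex.real_smul]; push_cast; ring
  have hMR : (0 : ℝ) < M := by exact_mod_cast hMpos
  have hX : 0 < (16 * ((M : ℂ) * w + 1)).im := by
    have : (16 * ((M : ℂ) * w + 1)).im = 16 * ((M : ℝ) * w.im) := by simp
    rw [this]; exact mul_pos (by norm_num) (mul_pos hMR w.im_pos)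
  have hY : 0 < (16 * ((M : ℂ) * ((((1 / 4 : ℝ) +ᵥ w : ℍ)) : ℂ) + 1)).im := by
    have : (16 * ((M : ℂ) * ((((1 / 4 : ℝ) +ᵥ w : ℍ)) : ℂ) + 1)).im = 16 * ((M : ℝ) * w.im) := by
      rw [coe_vadd]; simp
    rw [this]; exact mul_pos (by norm_num) (mul_pos hMR w.im_pos)
  rw [h1]
  refine junkTranslateSixteen_periodic_of_ratio hN4 hg γ₀ hM h256 hMpos.ne' hNc j₁ hNd (c • w) hX hY ?_
  have hden : (M : ℂ) * (((c • w : ℍ)) : ℂ) + 256 ≠ 0 := by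
    have h := im_level_mul_add_pos_sixteen hMpos (c • w) 0
    simp only [ofReal_zero, add_zero] at h
    intro h0; rw [h0] at h; simp at h
  have hden' : (16 : ℂ) * ((M : ℂ) * w + 1) ≠ 0 := by
    intro h0; rw [h0] at hX; simp at hX
  rw [div_eq_div_iff hden' hden, hcw, coe_vadd]
  push_cast
  ring

/-- **At the line's level `N = 4M`** (`M > 0` odd): the divisibilities `4M ∣ 64M²` and `4M ∣ 8M(8a + Mj₁)` hold, so the even translates of EVERY
`g ∈ halfIntModularForms κ (4M) ψ` at `W₁₆` are `(1/4)`-periodic after normalisation by `√(16(Mw+1))^κ`. [cite: Shimura1973HalfIntegral, §1] -/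
theorem junkTranslateSixteen_periodic_quarter_level {κ : ℕ} {M : ℕ} {ψ : DirichletCharacter ℂ (4 * M)} {g : ℍ → ℂ}
    (hg : g ∈ halfIntModularForms κ (4 * M) ψ) (γ₀ : SL(2, ℤ)) (hM : γ₀ 1 0 = (M : ℤ)) (h256 : γ₀ 1 1 = 256)
    (hMpos : 0 < M) (j₁ : ℤ) (c : {x : ℝ // 0 < x}) (hc : (c : ℝ) = 256) (w : ℍ) :
    g (((j₁ : ℝ) / 8) +ᵥ (γ₀ • (c • ((1 / 4 : ℝ) +ᵥ w)))) *
        (Complex.sqrt (16 * ((M : ℂ) * ((((1 / 4 : ℝ) +ᵥ w : ℍ)) : ℂ) + 1)) ^ κ)⁻¹ =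
      g (((j₁ : ℝ) / 8) +ᵥ (γ₀ • (c • w))) * (Complex.sqrt (16 * ((M : ℂ) * w + 1)) ^ κ)⁻¹ := by
  have hMZ : (0 : ℤ) < (M : ℤ) := by exact_mod_cast hMpos
  have hNc : ((4 * M : ℕ) : ℤ) ∣ 64 * (M : ℤ) ^ 2 := ⟨16 * (M : ℤ), by push_cast; ring⟩
  have hNd : ((4 * M : ℕ) : ℤ) ∣ 8 * (M : ℤ) * (8 * γ₀ 0 0 + (M : ℤ) * j₁) := ⟨2 * (8 * γ₀ 0 0 + (M : ℤ) * j₁), by push_cast; ring⟩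
  have h := junkTranslateSixteen_periodic_quarter (dvd_mul_right 4 M) hg γ₀ hM h256 hMZ hNc j₁ hNd c hc w
  have hMC : ((M : ℤ) : ℂ) = (M : ℂ) := by norm_cast
  rw [hMC] at h
  exact h

end Summit.BirchSwinnertonDyer.BirchSwinnertonDyer.Theorems.PrintCFram.FlipRung

end
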